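import Summits.CriticalPhenomena.SAWScalingLimit.Theorems.SAWRenewalTightnessStripMassConservation
import Mathlib.Topology.Algebra.InfiniteSum.Real
import HarnessLib

/-!
# Kesten's criticality identity `∑_{β irreducible bridge} x_c^{|β|} = 1`

(Crux `CriticalBubbleBound`, line kesten-product-renewal-dictionary, stub H5
`kestenIdentity_of_unbounded`; namespace
`Summit.CriticalPhenomena.SAWScalingLimit.Theorems.CriticalBubbleBound.Kesten.HW`.)

In the step-word model of `SAWWords.lean` / `SAWWordBridges.lean` (`IsIrrBridge w`: self-avoiding,
bridge, no break point, non-empty) we prove **Kesten's identity** (Kesten 1963, §4; Madras–Slade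
1993, eq. (4.2.4) together with Corollary 3.1.8): *if* the bridge generating polynomials
`B_N(x) = ∑_{w bridge SAW word, |w| ≤ N} x^{|w|}` are unbounded over `0 < x < x_c`, `N ∈ ℕ`
(the hypothesis; it is stub H3 of the line, Madras–Slade Corollary 3.1.8), *then*
`∑_{β irreducible bridge} x_c^{|β|} = 1` (as a `HasSum` over the subtype of irreducible bridges).

**Proof.**
* `≤ 1` and summability (`summable_irrBridge_pow`, `tsum_irrBridge_pow_le_one`): every finite
  partial sum is a Kraft sum `∑_{s ∈ S} x_c^{|s|} ≤ 1` over a finite set `S` of irreducible bridges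
  (`StripMass.sum_pow_criticalFugacity_le_one`, in tree), so the family is summable with sum
  `a ≤ 1` (`summable_of_sum_le`).
* `≥ 1` (`bridgeWordMass_le_one_add_mul`, `bridgeWordMass_le_of_tsum_lt_one`): the truncated
  renewal equation as an inequality, `B_N(x) ≤ 1 + A_N(x) · B_N(x)` for `0 ≤ x`, where
  `A_N(x) = ∑_{s irreducible, |s| ≤ N} x^{|s|}`: the empty word contributes `1` and every non-empty
  self-avoiding bridge word is `s ++ t` with `s` irreducible and `t` a bridge word
  (`StripMass.exists_irrBridge_append`; Madras–Slade (4.2.1)–(4.2.2)). For `x ≤ x_c`,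
  `A_N(x) ≤ a`; so if `a < 1` then `B_N(x) ≤ 1/(1-a)` uniformly in `x ≤ x_c` and `N`,
  contradicting the hypothesis. Hence `a = 1`.

Sources: H. Kesten, *On the number of self-avoiding walks*, J. Math. Phys. 4 (1963), §4;
N. Madras, G. Slade, *The Self-Avoiding Walk* (1993), §4.2, eq. (4.2.1)–(4.2.4), Corollary 3.1.8.
-/

noncomputable section

open Literature.Probability.LatticeModels
open Literature.Probability.RandomPlanarGeometry Literature.Probability.RandomPlanarGeometry.SAW
open scoped ENNReal NNReal BigOperators
open Classical

namespace Summit.CriticalPhenomena.SAWScalingLimit.Theorems.CriticalBubbleBound.Kesten.HW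

/-! ## The Kraft half: summability and `∑' ≤ 1` -/

/-- Partial sums of `x_c^{|β|}` over irreducible bridges are `≤ 1`: Kraft's inequality at `x_c`
(`StripMass.sum_pow_criticalFugacity_le_one`) transported to the subtype of irreducible bridges.
[cite: MadrasSlade1993, §4.2, eq. (4.2.4)] -/
theorem sum_irrBridge_pow_le_one (s : Finset {w : List Step // IsIrrBridge w}) :
    ∑ w ∈ s, criticalFugacity ^ w.1.length ≤ 1 := by
  have h := StripMass.sum_pow_criticalFugacity_le_one
    (S := s.map (Function.Embedding.subtype _)) (fun u hu => by
      obtain ⟨w, -, rfl⟩ := Finset.mem_map.1 hu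
      exact w.2)
  rwa [Finset.sum_map] at h

/-- The family `β ↦ x_c^{|β|}` over the irreducible bridges is summable (its partial sums are
bounded by `1`). [cite: MadrasSlade1993, §4.2, eq. (4.2.4)] -/
theorem summable_irrBridge_pow :
    Summable (fun w : {w : List Step // IsIrrBridge w} => criticalFugacity ^ w.1.length) :=
  summable_of_sum_le (fun _ => pow_nonneg StripMass.criticalFugacity_pos.le _)
    sum_irrBridge_pow_le_one

/-- `A(z_c) = ∑_{β irreducible bridge} x_c^{|β|} ≤ 1` (the easy half of Kesten's identity).
[cite: MadrasSlade1993, §4.2, eq. (4.2.4)] -/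
theorem tsum_irrBridge_pow_le_one :
    ∑' w : {w : List Step // IsIrrBridge w}, criticalFugacity ^ w.1.length ≤ 1 :=
  Real.tsum_le_of_sum_le (fun _ => pow_nonneg StripMass.criticalFugacity_pos.le _)
    sum_irrBridge_pow_le_one

/-- For a finite set `S` of irreducible bridges and `0 ≤ x ≤ x_c`,
`∑_{s ∈ S} x^{|s|} ≤ ∑_{β irreducible bridge} x_c^{|β|}` (monotonicity in `x`, then a partial sum of
a non-negative summable family). [cite: MadrasSlade1993, §4.2, eq. (4.2.4)] -/
theorem sum_pow_le_tsum_irrBridge {S : Finset (List Step)} (hS : Renewal.Admissible S) {x : ℝ}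
    (hx0 : 0 ≤ x) (hx : x ≤ criticalFugacity) :
    ∑ s ∈ S, x ^ s.length ≤
      ∑' w : {w : List Step // IsIrrBridge w}, criticalFugacity ^ w.1.length :=
  calc ∑ s ∈ S, x ^ s.length ≤ ∑ s ∈ S, criticalFugacity ^ s.length :=
        Finset.sum_le_sum fun _ _ => pow_le_pow_left₀ hx0 hx _
    _ = ∑ w ∈ S.subtype (fun w => IsIrrBridge w), criticalFugacity ^ w.1.length :=
        (Finset.sum_subtype_of_mem (fun s : List Step => criticalFugacity ^ s.length) hS).symm
    _ ≤ ∑' w : {w : List Step // IsIrrBridge w}, criticalFugacity ^ w.1.length :=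
        summable_irrBridge_pow.sum_le_tsum _
          (fun _ _ => pow_nonneg StripMass.criticalFugacity_pos.le _)

/-! ## The renewal inequality `B_N(x) ≤ 1 + A_N(x) · B_N(x)` -/

/-- Membership in the finite set of self-avoiding bridge words of length `≤ N`. [folklore] -/
theorem mem_bridgeWords_iff {N : ℕ} {w : List Step} :
    w ∈ (Finset.range (N + 1)).biUnion (fun n => (sawWords n).filter (fun w => IsBridgeW w)) ↔
      w.length ≤ N ∧ IsSAW w ∧ IsBridgeW w := by
  simp only [Finset.mem_biUnion, Finset.mem_range, Finset.mem_filter, mem_sawWords]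
  constructor
  · rintro ⟨n, hn, ⟨hl, hs⟩, hb⟩
    exact ⟨by omega, hs, hb⟩
  · rintro ⟨hl, hs, hb⟩
    exact ⟨w.length, by omega, ⟨rfl, hs⟩, hb⟩

/-- Membership in the finite set of irreducible bridges of length `≤ N`. [folklore] -/
theorem mem_irrWords_iff {N : ℕ} {s : List Step} :
    s ∈ ((Finset.range (N + 1)).biUnion sawWords).filter (fun s => IsIrrBridge s) ↔
      s.length ≤ N ∧ IsIrrBridge s := by
  simp only [Finset.mem_filter, Finset.mem_biUnion, Finset.mem_range, mem_sawWords]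
  constructor
  · rintro ⟨⟨n, hn, hl, -⟩, hi⟩
    exact ⟨by omega, hi⟩
  · rintro ⟨hl, hi⟩
    exact ⟨⟨s.length, by omega, rfl, hi.saw⟩, hi⟩

/-- **Renewal inequality** (the renewal equation, Madras–Slade (4.2.2), truncated at length `N`,
as an inequality): for `0 ≤ x` and every `N`, `B_N(x) ≤ 1 + A_N(x) · B_N(x)`, where `B_N(x)` is the
generating polynomial of the self-avoiding bridge words of length `≤ N` and `A_N(x)` that of the
irreducible bridges of length `≤ N`. The empty word contributes `x^0 = 1`; a non-empty bridge word
is `s ++ t` with `s` irreducible and `t` a bridge word (`StripMass.exists_irrBridge_append`), both of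
length `≤ N`, and `w ↦ (s, t)` is injective. [cite: MadrasSlade1993, §4.2, eq. (4.2.1)–(4.2.2)] -/
theorem bridgeWordMass_le_one_add_mul {x : ℝ} (hx : 0 ≤ x) (N : ℕ) :
    ∑ w ∈ (Finset.range (N + 1)).biUnion (fun n => (sawWords n).filter (fun w => IsBridgeW w)),
        x ^ w.length ≤
      1 + (∑ s ∈ ((Finset.range (N + 1)).biUnion sawWords).filter (fun s => IsIrrBridge s),
            x ^ s.length) *
        ∑ w ∈ (Finset.range (N + 1)).biUnion (fun n => (sawWords n).filter (fun w => IsBridgeW w)),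
          x ^ w.length := by
  set B := (Finset.range (N + 1)).biUnion (fun n => (sawWords n).filter (fun w => IsBridgeW w))
    with hBdef
  set S := ((Finset.range (N + 1)).biUnion sawWords).filter (fun s => IsIrrBridge s) with hSdef
  -- the empty word contributes at most `x^0 = 1`
  have h0 : ∑ w ∈ B.filter (fun w => w = []), x ^ w.length ≤ 1 :=
    calc ∑ w ∈ B.filter (fun w => w = []), x ^ w.length
        ≤ ∑ w ∈ ({[]} : Finset (List Step)), x ^ w.length :=
          Finset.sum_le_sum_of_subset_of_nonneg
            (fun w hw => Finset.mem_singleton.2 (Finset.mem_filter.1 hw).2)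
            fun _ _ _ => pow_nonneg hx _
      _ = 1 := by simp
  -- the non-empty words embed into pairs `(s, t)`, `s` irreducible, `t` a bridge word
  have hcover : B.filter (fun w => ¬ w = []) ⊆ (S ×ˢ B).image (fun p => p.1 ++ p.2) := by
    intro w hw
    obtain ⟨hwB, hne⟩ := Finset.mem_filter.1 hw
    obtain ⟨hl, hsaw, hb⟩ := mem_bridgeWords_iff.1 hwB
    obtain ⟨s, t, rfl, hsirr, ht⟩ := StripMass.exists_irrBridge_append hsaw hb hne
    rw [List.length_append] at hl
    have hsS : s ∈ S := mem_irrWords_iff.2 ⟨by omega, hsirr⟩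
    have htB : t ∈ B := by
      refine mem_bridgeWords_iff.2 ⟨by omega, ?_, ht⟩
      have := hsaw.drop s.length
      rwa [List.drop_left] at this
    exact Finset.mem_image.2 ⟨(s, t), Finset.mem_product.2 ⟨hsS, htB⟩, rfl⟩
  have h1 : ∑ w ∈ B.filter (fun w => ¬ w = []), x ^ w.length ≤
      (∑ s ∈ S, x ^ s.length) * ∑ w ∈ B, x ^ w.length :=
    calc ∑ w ∈ B.filter (fun w => ¬ w = []), x ^ w.length
        ≤ ∑ w ∈ (S ×ˢ B).image (fun p => p.1 ++ p.2), x ^ w.length :=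
          Finset.sum_le_sum_of_subset_of_nonneg hcover fun _ _ _ => pow_nonneg hx _
      _ ≤ ∑ p ∈ S ×ˢ B, x ^ (p.1 ++ p.2).length :=
          Finset.sum_image_le_of_nonneg fun _ _ => pow_nonneg hx _
      _ = (∑ s ∈ S, x ^ s.length) * ∑ w ∈ B, x ^ w.length := by
          rw [Finset.sum_product, Finset.sum_mul_sum]
          simp only [List.length_append, pow_add]
  calc ∑ w ∈ B, x ^ w.length
      = ∑ w ∈ B.filter (fun w => w = []), x ^ w.length +
          ∑ w ∈ B.filter (fun w => ¬ w = []), x ^ w.length :=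
        (Finset.sum_filter_add_sum_filter_not B (fun w => w = []) _).symm
    _ ≤ 1 + (∑ s ∈ S, x ^ s.length) * ∑ w ∈ B, x ^ w.length := add_le_add h0 h1

/-- **Uniform bound from `A(z_c) < 1`**: if `a := ∑_{β irreducible bridge} x_c^{|β|} < 1`, the
renewal inequality gives `B_N(x) ≤ 1 / (1 - a)` for all `0 ≤ x ≤ x_c` and all `N` (since
`A_N(x) ≤ a`), i.e. the bridge generating function would stay bounded up to `x_c`
(cf. Madras–Slade (4.2.3): `B(z) = 1/(1 - A(z))` for `z < z_c`).
[cite: MadrasSlade1993, §4.2, eq. (4.2.2)–(4.2.4)] -/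
theorem bridgeWordMass_le_of_tsum_lt_one
    (ha : ∑' w : {w : List Step // IsIrrBridge w}, criticalFugacity ^ w.1.length < 1)
    {x : ℝ} (hx0 : 0 ≤ x) (hx : x ≤ criticalFugacity) (N : ℕ) :
    ∑ w ∈ (Finset.range (N + 1)).biUnion (fun n => (sawWords n).filter (fun w => IsBridgeW w)),
        x ^ w.length ≤
      1 / (1 - ∑' w : {w : List Step // IsIrrBridge w}, criticalFugacity ^ w.1.length) := by
  set a := ∑' w : {w : List Step // IsIrrBridge w}, criticalFugacity ^ w.1.length with hadef
  set b := ∑ w ∈ (Finset.range (N + 1)).biUnion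
      (fun n => (sawWords n).filter (fun w => IsBridgeW w)), x ^ w.length with hbdef
  have hb0 : 0 ≤ b := Finset.sum_nonneg fun _ _ => pow_nonneg hx0 _
  have hA : ∑ s ∈ ((Finset.range (N + 1)).biUnion sawWords).filter (fun s => IsIrrBridge s),
      x ^ s.length ≤ a :=
    sum_pow_le_tsum_irrBridge (fun s hs => (Finset.mem_filter.1 hs).2) hx0 hx
  have h1 : b ≤ 1 + a * b :=
    (bridgeWordMass_le_one_add_mul hx0 N).trans
      (add_le_add_right (mul_le_mul_of_nonneg_right hA hb0) 1)
  rw [le_div_iff₀ (sub_pos.2 ha)]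
  have h2 : b * (1 - a) = b - a * b := by ring
  rw [h2]
  linarith

/-! ## Kesten's identity -/

/-- **Kesten's criticality identity** `∑_{β irreducible bridge} x_c^{|β|} = 1` (Kesten 1963, §4;
Madras–Slade (4.2.4)), from the divergence of the bridge generating function at `x_c`
(the hypothesis, Madras–Slade Corollary 3.1.8, in the word model): the sum `a` exists and is `≤ 1`
by Kraft's inequality (`tsum_irrBridge_pow_le_one`); if `a < 1` the renewal inequality would bound
`B_N(x) ≤ 1/(1-a)` uniformly in `0 < x < x_c` and `N` (`bridgeWordMass_le_of_tsum_lt_one`),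
contradicting the hypothesis; hence `a = 1`. [cite: MadrasSlade1993, §4.2, eq. (4.2.4)] -/
theorem kestenIdentity_of_unbounded : (∀ M : ℝ, ∃ x : ℝ, 0 < x ∧ x < criticalFugacity ∧ ∃ N : ℕ,
    M ≤ ∑ w ∈ (Finset.range (N + 1)).biUnion (fun n => (sawWords n).filter (fun w => IsBridgeW w)),
      x ^ w.length) →
    HasSum (fun w : {w : List Literature.Probability.RandomPlanarGeometry.SAW.Step //
        Literature.Probability.RandomPlanarGeometry.SAW.IsIrrBridge w} =>
      Literature.Probability.RandomPlanarGeometry.SAW.criticalFugacity ^ w.1.length) 1 := by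
  intro hunb
  have hle : ∑' w : {w : List Step // IsIrrBridge w}, criticalFugacity ^ w.1.length ≤ 1 :=
    tsum_irrBridge_pow_le_one
  have hge : 1 ≤ ∑' w : {w : List Step // IsIrrBridge w}, criticalFugacity ^ w.1.length := by
    by_contra hlt
    rw [not_le] at hlt
    obtain ⟨x, hx0, hxc, N, hM⟩ := hunb
      (1 / (1 - ∑' w : {w : List Step // IsIrrBridge w}, criticalFugacity ^ w.1.length) + 1)
    have hbd := bridgeWordMass_le_of_tsum_lt_one hlt hx0.le hxc.le N
    linarith
  have h1 : ∑' w : {w : List Step // IsIrrBridge w}, criticalFugacity ^ w.1.length = 1 :=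
    le_antisymm hle hge
  have h := summable_irrBridge_pow.hasSum
  rwa [h1] at h

end Summit.CriticalPhenomena.SAWScalingLimit.Theorems.CriticalBubbleBound.Kesten.HW

end
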